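import Summits.ResolutionOfSingularities.ResolutionOfSingularities.Theorems.FrobeniusLadderFInjectiveMacaulayficationG1CornerGradedData
import Summits.ResolutionOfSingularities.ResolutionOfSingularities.Theorems.FrobeniusLadderFInjectiveMacaulayficationE8Forms
import Mathlib.RingTheory.MvPolynomial.WeightedHomogeneous
import Mathlib.Algebra.MvPolynomial.PDeriv
import Mathlib.Algebra.MvPolynomial.Equiv
import Mathlib.Algebra.Polynomial.Degree.Domain
import Mathlib.RingTheory.Polynomial.UniqueFactorization
import Mathlib.RingTheory.Ideal.Quotient.Operations
import HarnessLib

/-!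
# tri-1's G1-outside-graded specimen `f = z² + x³y² + y³ + xy⁴` as a `(2,6,9)`-FILTERED specimen: characteristic-free data
# (crux `FInjectiveMacaulayfication`, line `graded-engine` §17 filtered engine G4♮/G5♮, calibration G6f)

Support file for crux stmt-ResolutionOfSingularities-15315 (`FrobeniusLadder.FInjectiveMacaulayfication`), chain w45a,
seat res-L1-w45a-stub-3. [OURS · L1 W4.5a, CRUX-PLAN v4 §4 (filtered calibrations); tri-1 TRIAGE §12 specimen] — NOT a
statement of the manuscript; AI-written, weaker than expert review.

`f = X₂² + X₀³X₁² + X₁³ + X₀X₁⁴` (`X₀ = x`, `X₁ = y`, `X₂ = z`) is tri-1's corner specimen OUTSIDE the graded class: it is not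
quasi-homogeneous for any positive weights, but semi-quasi-homogeneous for `w = (2,6,9)` with initial form the corner specimen
`g = X₂² + X₀³X₁² + X₁³` (weight `18`; the tail `X₀X₁⁴` has weight `26`), singular along the same line `L = {X₁ = X₂ = 0}`. The
filtered engine G5♮ (`FilteredEngine.filteredConeFiModel_of_filteredChartClause`, `N = 18`, `c = (9,3,2)`, `D = 18`) consumes,
besides stub-1's corner data (`G1CornerVeroneseSplitting`, `G1CornerGradedData`: saturation and the cone clause `hoff₀`), the
following data of `f` itself, characteristic-free and proved here:

* `tail_isWeightedHomogeneous` (weight `26`) and the INITIAL-FORM facts `weightedHomogeneousComponent_eighteen` (`= g`),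
  `weightedHomogeneousComponent_lt_eighteen` (`= 0`), `g_ne_zero`;
* `prime_g1Tail` — `f` is prime over EVERY field and divides no variable (`k[X] ≃ k[Y₀,Y₁][T]`, `X₂ ↦ T`, `f ↦ T² + c`,
  `c(−T, 0) = −T³`: `E8Forms`), `span_g1Tail_isPrime`, `g1Tail_X_ne_zero`;
* `pderiv_zero_g1Tail` (`∂₀f = X₁²(3X₀² + X₁²)`), `pderiv_one_g1Tail` (`∂₁f = X₁(2X₀³ + 3X₁ + 4X₀X₁²)`), `pderiv_two_g1Tail`
  (`∂₂f = 2X₂`), and the two Jacobian IDENTITIES `jacobian_identity_one` (`3v − X₀w₀ = X₁(3 + 2X₀X₁)`) and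
  `jacobian_identity_two` (`4X₀³ = X₁(3 + 2X₀X₁) + 2X₀w₀ − w₁`) with `v = X₀³ + X₁ + X₀X₁²`, `w₀ = 3X₀² + X₁²`,
  `w₁ = 2X₀³ + 3X₁ + 4X₀X₁²` — they show that off `L` no closed point of `V(f)` is singular at odd `p`.

The off-origin clause at every odd `p` and the model modulo G5♮ are in the companion file `…G1TailFilteredFiModel`. All proofs
are glue on Mathlib and landed files; no definitions, no named facts. [folklore]
-/

-- single-problem summit: the doubled namespace component is forced
set_option linter.dupNamespace false

noncomputable section

namespace Summit.ResolutionOfSingularities.ResolutionOfSingularities.Theorems.FInjectiveMacaulayfication.G1TailData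

open MvPolynomial
open Summit.ResolutionOfSingularities.ResolutionOfSingularities.Theorems.FInjectiveMacaulayfication

/-! ## The initial form of `f` for the weights `(2,6,9)` -/

/-- The tail `X₀X₁⁴` is `(2,6,9)`-weighted-homogeneous of weight `26`. [folklore] -/
theorem tail_isWeightedHomogeneous (k : Type) [Field k] :
    MvPolynomial.IsWeightedHomogeneous (![2, 6, 9] : Fin 3 → ℕ) (X 0 * X 1 ^ 4 : MvPolynomial (Fin 3) k) 26 := by
  simpa using (isWeightedHomogeneous_X k (![2, 6, 9] : Fin 3 → ℕ) 0).mul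
    ((isWeightedHomogeneous_X k (![2, 6, 9] : Fin 3 → ℕ) 1).pow 4)

/-- **The `(2,6,9)`-weight-`18` component of `f` is the corner specimen `g = X₂² + X₀³X₁² + X₁³`.** [folklore] -/
theorem weightedHomogeneousComponent_eighteen (k : Type) [Field k] (f : MvPolynomial (Fin 3) k)
    (hf : f = X 2 ^ 2 + X 0 ^ 3 * X 1 ^ 2 + X 1 ^ 3 + X 0 * X 1 ^ 4) :
    MvPolynomial.weightedHomogeneousComponent (![2, 6, 9] : Fin 3 → ℕ) 18 f = X 2 ^ 2 + X 0 ^ 3 * X 1 ^ 2 + X 1 ^ 3 := by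
  rw [hf, map_add, (G1CornerGradedData.g1_isWeightedHomogeneous k).weightedHomogeneousComponent_same,
    (tail_isWeightedHomogeneous k).weightedHomogeneousComponent_ne 18 (by norm_num), add_zero]

/-- **`f` has `(2,6,9)`-order `18`**: all weighted-homogeneous components below `18` vanish. [folklore] -/
theorem weightedHomogeneousComponent_lt_eighteen (k : Type) [Field k] (f : MvPolynomial (Fin 3) k)
    (hf : f = X 2 ^ 2 + X 0 ^ 3 * X 1 ^ 2 + X 1 ^ 3 + X 0 * X 1 ^ 4) :
    ∀ m < 18, MvPolynomial.weightedHomogeneousComponent (![2, 6, 9] : Fin 3 → ℕ) m f = 0 := by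
  intro m hm
  rw [hf, map_add, (G1CornerGradedData.g1_isWeightedHomogeneous k).weightedHomogeneousComponent_ne m (by omega),
    (tail_isWeightedHomogeneous k).weightedHomogeneousComponent_ne m (by omega), add_zero]

/-- `g ≠ 0` (it takes the value `1` at `(0,0,1)`). [folklore] -/
theorem g_ne_zero (k : Type) [Field k] : (X 2 ^ 2 + X 0 ^ 3 * X 1 ^ 2 + X 1 ^ 3 : MvPolynomial (Fin 3) k) ≠ 0 := by
  intro h0
  have h1 := congrArg (MvPolynomial.eval ![(0 : k), 0, 1]) h0
  simp at h1

/-! ## Primality over every field -/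

/-- **`f = X₂² + X₀³X₁² + X₁³ + X₀X₁⁴` is prime over every field and divides no variable.** Identify `k[X₀,X₁,X₂]` with
`k[Y₀,Y₁][T]` (`X₂ ↦ T`, `X₀ ↦ C Y₁`, `X₁ ↦ C Y₀`); `f ↦ T² + c`, `c = Y₁³Y₀² + Y₀³ + Y₁Y₀⁴`, and `c(−T, 0) = −T³` is the
odd-degree non-square witness. [folklore] -/
theorem prime_g1Tail (k : Type) [Field k] (f : MvPolynomial (Fin 3) k)
    (hf : f = X 2 ^ 2 + X 0 ^ 3 * X 1 ^ 2 + X 1 ^ 3 + X 0 * X 1 ^ 4) :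
    Prime f ∧ ∀ v : Fin 3, ¬ f ∣ MvPolynomial.X v := by
  obtain ⟨e, he0, he1, he2⟩ : ∃ e : MvPolynomial (Fin 3) k ≃+* Polynomial (MvPolynomial (Fin 2) k),
      e (X 0) = Polynomial.C (X 1) ∧ e (X 1) = Polynomial.C (X 0) ∧ e (X 2) = Polynomial.X := by
    refine ⟨((renameEquiv k (Equiv.swap (0 : Fin 3) 2)).trans (finSuccEquiv k 2)).toRingEquiv, ?_, ?_, ?_⟩
    · show finSuccEquiv k 2 (rename (Equiv.swap (0 : Fin 3) 2) (X 0)) = _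
      rw [rename_X, Equiv.swap_apply_left]
      exact finSuccEquiv_X_succ (j := 1)
    · show finSuccEquiv k 2 (rename (Equiv.swap (0 : Fin 3) 2) (X 1)) = _
      rw [rename_X, Equiv.swap_apply_of_ne_of_ne (by decide) (by decide)]
      exact finSuccEquiv_X_succ (j := 0)
    · show finSuccEquiv k 2 (rename (Equiv.swap (0 : Fin 3) 2) (X 2)) = _
      rw [rename_X, Equiv.swap_apply_right]
      exact finSuccEquiv_X_zero
  have hef : e f = Polynomial.X ^ 2 +
      Polynomial.C (X 1 ^ 3 * X 0 ^ 2 + X 0 ^ 3 + X 1 * X 0 ^ 4 : MvPolynomial (Fin 2) k) := by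
    subst hf
    simp only [map_add, map_mul, map_pow, he0, he1, he2]
    ring
  have hc : ∀ a : MvPolynomial (Fin 2) k, a * a ≠ -(X 1 ^ 3 * X 0 ^ 2 + X 0 ^ 3 + X 1 * X 0 ^ 4) :=
    E8Forms.mul_self_ne_neg_of_aeval ![-Polynomial.X, 0] 1 (by
      simp only [map_add, map_mul, map_pow, MvPolynomial.aeval_X, Matrix.cons_val_zero, Matrix.cons_val_one]
      ring)
  obtain ⟨hp, hnd⟩ := E8Forms.prime_and_not_dvd_of_ringEquiv e f _ hef hc
  refine ⟨hp, fun v => ?_⟩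
  fin_cases v
  · exact hnd (X 0) (X 1) (X_ne_zero 1) he0
  · exact hnd (X 1) (X 0) (X_ne_zero 0) he1
  · rintro ⟨q, hq⟩
    have h1 : (Polynomial.X ^ 2 + Polynomial.C (X 1 ^ 3 * X 0 ^ 2 + X 0 ^ 3 + X 1 * X 0 ^ 4) :
        Polynomial (MvPolynomial (Fin 2) k)) ∣ Polynomial.X :=
      ⟨e q, by rw [← hef, ← map_mul, ← hq]; exact he2.symm⟩
    have h2 := Polynomial.natDegree_le_of_dvd h1 Polynomial.X_ne_zero
    rw [Polynomial.natDegree_X_pow_add_C, Polynomial.natDegree_X] at h2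
    omega

/-- `(f)` is a prime ideal. [folklore] -/
theorem span_g1Tail_isPrime (k : Type) [Field k] (f : MvPolynomial (Fin 3) k)
    (hf : f = X 2 ^ 2 + X 0 ^ 3 * X 1 ^ 2 + X 1 ^ 3 + X 0 * X 1 ^ 4) : (Ideal.span {f}).IsPrime :=
  (Ideal.span_singleton_prime (prime_g1Tail k f hf).1.ne_zero).mpr (prime_g1Tail k f hf).1

/-- No variable lies in `(f)`. [folklore] -/
theorem g1Tail_X_ne_zero (k : Type) [Field k] (f : MvPolynomial (Fin 3) k)
    (hf : f = X 2 ^ 2 + X 0 ^ 3 * X 1 ^ 2 + X 1 ^ 3 + X 0 * X 1 ^ 4) (v : Fin 3) :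
    Ideal.Quotient.mk (Ideal.span {f}) (MvPolynomial.X v) ≠ 0 := fun h0 =>
  (prime_g1Tail k f hf).2 v (Ideal.mem_span_singleton.mp (Ideal.Quotient.eq_zero_iff_mem.mp h0))

/-! ## Partial derivatives and the Jacobian identities -/

/-- `∂₀ f = X₁²(3X₀² + X₁²)`. [folklore] -/
theorem pderiv_zero_g1Tail {A : Type*} [CommRing A] :
    pderiv 0 (X 2 ^ 2 + X 0 ^ 3 * X 1 ^ 2 + X 1 ^ 3 + X 0 * X 1 ^ 4 : MvPolynomial (Fin 3) A) =
      X 1 ^ 2 * (3 * X 0 ^ 2 + X 1 ^ 2) := by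
  simp only [map_add, pderiv_mul, pderiv_pow, pderiv_X_self,
    pderiv_X_of_ne (show (1 : Fin 3) ≠ 0 by decide), pderiv_X_of_ne (show (2 : Fin 3) ≠ 0 by decide)]
  norm_num
  ring

/-- `∂₁ f = X₁(2X₀³ + 3X₁ + 4X₀X₁²)`. [folklore] -/
theorem pderiv_one_g1Tail {A : Type*} [CommRing A] :
    pderiv 1 (X 2 ^ 2 + X 0 ^ 3 * X 1 ^ 2 + X 1 ^ 3 + X 0 * X 1 ^ 4 : MvPolynomial (Fin 3) A) =
      X 1 * (2 * X 0 ^ 3 + 3 * X 1 + 4 * X 0 * X 1 ^ 2) := by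
  simp only [map_add, pderiv_mul, pderiv_pow, pderiv_X_self,
    pderiv_X_of_ne (show (0 : Fin 3) ≠ 1 by decide), pderiv_X_of_ne (show (2 : Fin 3) ≠ 1 by decide)]
  norm_num
  ring

/-- `∂₂ f = 2X₂`. [folklore] -/
theorem pderiv_two_g1Tail {A : Type*} [CommRing A] :
    pderiv 2 (X 2 ^ 2 + X 0 ^ 3 * X 1 ^ 2 + X 1 ^ 3 + X 0 * X 1 ^ 4 : MvPolynomial (Fin 3) A) = 2 * X 2 := by
  simp only [map_add, pderiv_mul, pderiv_pow, pderiv_X_self,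
    pderiv_X_of_ne (show (0 : Fin 3) ≠ 2 by decide), pderiv_X_of_ne (show (1 : Fin 3) ≠ 2 by decide)]
  norm_num

/-- **First Jacobian identity**: `3v − X₀w₀ = X₁(3 + 2X₀X₁)` with `v = X₀³ + X₁ + X₀X₁²` (so that `f = X₂² + X₁²v`) and
`w₀ = 3X₀² + X₁²` (so that `∂₀f = X₁²w₀`). [folklore] -/
theorem jacobian_identity_one {A : Type*} [CommRing A] (x y : A) :
    3 * (x ^ 3 + y + x * y ^ 2) - x * (3 * x ^ 2 + y ^ 2) = y * (3 + 2 * x * y) := by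
  ring

/-- **Second Jacobian identity**: `4X₀³ = X₁(3 + 2X₀X₁) + 2X₀w₀ − w₁` with `w₁ = 2X₀³ + 3X₁ + 4X₀X₁²` (so that `∂₁f = X₁w₁`).
[folklore] -/
theorem jacobian_identity_two {A : Type*} [CommRing A] (x y : A) :
    4 * x ^ 3 = y * (3 + 2 * x * y) + 2 * x * (3 * x ^ 2 + y ^ 2) - (2 * x ^ 3 + 3 * y + 4 * x * y ^ 2) := by
  ring

end Summit.ResolutionOfSingularities.ResolutionOfSingularities.Theorems.FInjectiveMacaulayfication.G1TailData

end
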